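import Mathlib
import Summits.MatrixMultiplication.MatrixMultiplication.Theses.SnSubsetDichotomy
import Summits.MatrixMultiplication.MatrixMultiplication.Theorems.SnSubsetDichotomyJuntaBranchSameTargetCaps
import Summits.MatrixMultiplication.MatrixMultiplication.Theorems.SnSubsetDichotomyJuntaBranchAtoms

/-!
# `SnSubsetDichotomy.JuntaBranch` — ALIGNED-OR-ABSENT forces high-level bump exclusion
# (crux stmt-MatrixMultiplication-8304, line `Sketch`, card alignment-trichotomy)

Crux `stmt-MatrixMultiplication-8304` (`JuntaBranch`, route `SnSubsetDichotomy`), line `Sketch`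
(card `alignment-trichotomy`).  Notation: for `X ⊆ S_n`, an injective source tuple
`I : Fin t → Fin n` and a target tuple `L`, the block of `X` at `(I → L)` is
`X_I := {σ ∈ X | σ ∘ I = L}`; `D := n^{(t)} = n!/(n-t)!`, `F := n!`, `F_t := (n-t)!`,
`V := |S||T||U|`.  A TPP triple is `Large(c)` when `F^{3/2} e^{-c√n} ≤ V`; an `ε`-bump of `S`
at `(I → L)` is `n^{(1/2+ε)t}|S| < |S_I|·D`; the bump is *aligned* when there are injective
`J, P` with `e^{c+1} V (F_t/F)^{3/2} ≤ |S_I||T_J||U_P|`.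

The registered stub `stub_alignedOrAbsent` of the line (the card's transfer target `C⁺` in
first-set form) says that, eventually in `n`, every bump of a `Large(c)` TPP triple at a level
`1 ≤ t ≤ √n` is aligned.  `noHighBump_of_alignedOrAbsent` shows what this hypothesis CONTAINS:
at the levels `t` with `2c√n ≤ εt·log n + c + 1`, `Large(c)` TPP triples then carry NO `ε`-bump
at all — a `∀ c` high-level bump-exclusion statement of Global-branch type.

Mechanism (same-target packing caps, file `SnSubsetDichotomyJuntaBranchSameTargetCaps`): an
aligned bump would give `|S_I| · e^{c+1} V (F_t/F)^{3/2} ≤ |S_I|²|T_J||U_P| ≤ F_t²`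
(`sameTarget_sq_cap`), and with `Large(c)` this reads `|S_I| ≤ √F_t · e^{c√n-c-1}`; the
member floor `√F e^{-c√n} ≤ |S|` (`sqrt_factorial_le_card_of_large`), `F = F_t · D` and
`D ≤ n^t` turn the bump into `n^{εt} < e^{2c√n-c-1}`, i.e. `εt·log n + c + 1 < 2c√n`.
-/

set_option linter.dupNamespace false

open Literature.Combinatorics.Additive
open Summit.MatrixMultiplication.MatrixMultiplication.Theses.SnSubsetDichotomy
open scoped Classical

namespace Summit.MatrixMultiplication.MatrixMultiplication.Theorems.JuntaBranch

/-- **ALIGNED-OR-ABSENT forces high-level bump exclusion** (registered sub-goal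
`noHighBump_of_alignedOrAbsent` of crux stmt-MatrixMultiplication-8304, line `Sketch`).
If, for all `ε, c > 0` and `n ≥ n₀(ε, c)`, every `ε`-bump `(I → L)` of level `1 ≤ t ≤ √n`
of the first set of a `Large(c)` TPP triple `S, T, U ⊆ S_n` is aligned (injective `J, P` with
`e^{c+1}|S||T||U|((n-t)!/n!)^{3/2} ≤ |S_I||T_J||U_P|`), then for all `ε, c > 0` and
`n ≥ n₀(ε, c)`, a `Large(c)` TPP triple has no `ε`-bump at any level `1 ≤ t ≤ √n` with
`2c√n ≤ εt·log n + c + 1`: `|S_I|·n^{(t)} ≤ n^{(1/2+ε)t}|S|` for all injective `I, L`.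
Proof: the same-target square cap `|S_I|²|T_J||U_P| ≤ ((n-t)!)²` against the alignment gain and
the member floor `√(n!)e^{-c√n} ≤ |S|` give `εt·log n + c + 1 < 2c√n`. -/
theorem noHighBump_of_alignedOrAbsent : (∀ ε : ℝ, 0 < ε → ∀ c : ℝ, 0 < c → ∃ n₀ : ℕ, ∀ n ≥ n₀, ∀ S T U : Finset (Equiv.Perm (Fin n)), TripleProductProperty S T U → (n.factorial : ℝ) ^ ((3 : ℝ) / 2) * Real.exp (-(c * Real.sqrt (n : ℝ))) ≤ ((S.card * T.card * U.card : ℕ) : ℝ) → ∀ t : ℕ, 1 ≤ t → (t : ℝ) ≤ Real.sqrt (n : ℝ) → ∀ I L : Fin t → Fin n, Function.Injective I → Function.Injective L → (n : ℝ) ^ ((1 / 2 + ε) * t) * (S.card : ℝ) < ((S.filter (fun σ => ∀ k, σ (I k) = L k)).card : ℝ) * (n.descFactorial t : ℝ) → ∃ J P : Fin t → Fin n, Function.Injective J ∧ Function.Injective P ∧ Real.exp (c + 1) * ((S.card * T.card * U.card : ℕ) : ℝ) * ((((n - t).factorial : ℕ) : ℝ) / (n.factorial : ℝ)) ^ ((3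 : ℝ) / 2) ≤ (((S.filter (fun σ => ∀ k, σ (I k) = L k)).card * (T.filter (fun σ => ∀ k, σ (J k) = L k)).card * (U.filter (fun σ => ∀ k, σ (P k) = L k)).card : ℕ) : ℝ)) → ∀ ε : ℝ, 0 < ε → ∀ c : ℝ, 0 < c → ∃ n₀ : ℕ, ∀ n ≥ n₀, ∀ S T U : Finset (Equiv.Perm (Fin n)), TripleProductProperty S T U → (n.factorial : ℝ) ^ ((3 : ℝ) / 2) * Real.exp (-(c * Real.sqrt (n : ℝ))) ≤ ((S.card * T.card * U.card : ℕ) : ℝ) → ∀ t : ℕ, 1 ≤ t → (t : ℝ) ≤ Real.sqrt (n : ℝ) → 2 * c * Real.sqrt (n : ℝ) ≤ ε * t * Real.log (n : ℝ) + c + 1 → ∀ I L : Fin t → Fin n, Function.Injective I → Function.Injective L → ((S.filter (fun σ => ∀ k, σ (I k) = L k)).card : ℝ) * (n.descFactorial t : ℝ) ≤ (n : ℝ) ^ ((1 / 2 + ε) * t) * (S.card : ℝ) := by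
  intro hAligned ε hε c hc
  obtain ⟨n₀, h₀⟩ := hAligned ε hε c hc
  refine ⟨n₀, fun n hn S T U hTPP hLarge t ht1 htn hlevel I L hI hL => ?_⟩
  by_contra hb'
  have hb := not_le.mp hb'
  -- (1) alignment of the bump, (2) non-emptiness, (3) the same-target square cap, (5) the floor
  obtain ⟨J, P, hJ, hP, hgain⟩ := h₀ n hn S T U hTPP hLarge t ht1 htn I L hI hL hb
  obtain ⟨-, hT, hU⟩ := nonempty_of_large hLarge
  have hcap := sameTarget_sq_cap hTPP hT hU I J P L hI hJ hP
  have hfloor := sqrt_factorial_le_card_of_large hTPP hLarge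
  -- (0) `D = n^{(t)} > 0`, hence `t ≤ n` and `0 < n`
  have hDpos_nat : 0 < n.descFactorial t := by
    refine Nat.pos_of_ne_zero (fun h0 => ?_)
    rw [h0, Nat.cast_zero, mul_zero] at hb
    exact absurd hb (not_lt.mpr (mul_nonneg (Real.rpow_nonneg (Nat.cast_nonneg n) _)
      (Nat.cast_nonneg _)))
  have htn' : t ≤ n :=
    not_lt.mp (fun h => hDpos_nat.ne' (Nat.descFactorial_eq_zero_iff_lt.mpr h))
  have hnpos : (0 : ℝ) < n := by exact_mod_cast (show 0 < n by omega)
  -- real versions of the arithmetic facts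
  have hF : (0 : ℝ) < (n.factorial : ℝ) := by exact_mod_cast n.factorial_pos
  have hFt : (0 : ℝ) < (((n - t).factorial : ℕ) : ℝ) := by
    exact_mod_cast (n - t).factorial_pos
  have hD : (0 : ℝ) < (n.descFactorial t : ℝ) := by exact_mod_cast hDpos_nat
  have hFD : (n.factorial : ℝ) = (((n - t).factorial : ℕ) : ℝ) * (n.descFactorial t : ℝ) :=
    by exact_mod_cast (Nat.factorial_mul_descFactorial htn').symm
  have hDle : (n.descFactorial t : ℝ) ≤ (n : ℝ) ^ t := by
    exact_mod_cast Nat.descFactorial_le_pow n t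
  have hcapR : ((S.filter (fun σ => ∀ k, σ (I k) = L k)).card : ℝ) ^ 2 *
      ((T.filter (fun σ => ∀ k, σ (J k) = L k)).card : ℝ) *
      ((U.filter (fun σ => ∀ k, σ (P k) = L k)).card : ℝ) ≤
      (((n - t).factorial : ℕ) : ℝ) ^ 2 := by
    exact_mod_cast hcap
  have hprod : (((S.filter (fun σ => ∀ k, σ (I k) = L k)).card *
      (T.filter (fun σ => ∀ k, σ (J k) = L k)).card *
      (U.filter (fun σ => ∀ k, σ (P k) = L k)).card : ℕ) : ℝ) =
      ((S.filter (fun σ => ∀ k, σ (I k) = L k)).card : ℝ) *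
      ((T.filter (fun σ => ∀ k, σ (J k) = L k)).card : ℝ) *
      ((U.filter (fun σ => ∀ k, σ (P k) = L k)).card : ℝ) := by
    rw [Nat.cast_mul, Nat.cast_mul]
  rw [hprod] at hgain
  -- names
  set a : ℝ := ((S.filter (fun σ => ∀ k, σ (I k) = L k)).card : ℝ)
  set b : ℝ := ((T.filter (fun σ => ∀ k, σ (J k) = L k)).card : ℝ)
  set u : ℝ := ((U.filter (fun σ => ∀ k, σ (P k) = L k)).card : ℝ)
  set s : ℝ := (S.card : ℝ)
  set V : ℝ := ((S.card * T.card * U.card : ℕ) : ℝ)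
  set D : ℝ := (n.descFactorial t : ℝ)
  set F : ℝ := (n.factorial : ℝ)
  set Ft : ℝ := (((n - t).factorial : ℕ) : ℝ)
  set e : ℝ := Real.exp (-(c * Real.sqrt (n : ℝ))) with he_def
  set e1 : ℝ := Real.exp (c + 1) with he1_def
  set q : ℝ := (n : ℝ) ^ ((1 / 2 + ε) * (t : ℝ)) with hq_def
  have he : 0 < e := Real.exp_pos _
  have he1 : 0 < e1 := Real.exp_pos _
  have hq : 0 < q := Real.rpow_pos_of_pos hnpos _
  have ha0 : 0 ≤ a := Nat.cast_nonneg _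
  have hF32 : 0 < F ^ ((3 : ℝ) / 2) := Real.rpow_pos_of_pos hF _
  have hFt32 : 0 < Ft ^ ((3 : ℝ) / 2) := Real.rpow_pos_of_pos hFt _
  -- (4) alignment gain against `Large` and the square cap: `a · e^{c+1} e^{-c√n} ≤ √F_t`
  have hdiv : (Ft / F) ^ ((3 : ℝ) / 2) * F ^ ((3 : ℝ) / 2) = Ft ^ ((3 : ℝ) / 2) := by
    rw [Real.div_rpow hFt.le hF.le, div_mul_cancel₀ _ hF32.ne']
  have h1 : e1 * e * Ft ^ ((3 : ℝ) / 2) ≤ a * b * u := by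
    calc e1 * e * Ft ^ ((3 : ℝ) / 2)
        = e1 * (F ^ ((3 : ℝ) / 2) * e) * (Ft / F) ^ ((3 : ℝ) / 2) := by rw [← hdiv]; ring
      _ ≤ e1 * V * (Ft / F) ^ ((3 : ℝ) / 2) :=
          mul_le_mul_of_nonneg_right (mul_le_mul_of_nonneg_left hLarge he1.le)
            (Real.rpow_nonneg (div_nonneg hFt.le hF.le) _)
      _ ≤ a * b * u := hgain
  have h2 : a * (e1 * e) * Ft ^ ((3 : ℝ) / 2) ≤ Real.sqrt Ft * Ft ^ ((3 : ℝ) / 2) := by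
    calc a * (e1 * e) * Ft ^ ((3 : ℝ) / 2) = a * (e1 * e * Ft ^ ((3 : ℝ) / 2)) := by ring
      _ ≤ a * (a * b * u) := mul_le_mul_of_nonneg_left h1 ha0
      _ = a ^ 2 * b * u := by ring
      _ ≤ Ft ^ 2 := hcapR
      _ = Real.sqrt Ft * Ft ^ ((3 : ℝ) / 2) := by
          rw [Real.sqrt_eq_rpow, ← Real.rpow_add hFt, show (1 / 2 : ℝ) + 3 / 2 = 2 by norm_num,
            Real.rpow_two]
  have hA : a * (e1 * e) ≤ Real.sqrt Ft := le_of_mul_le_mul_right h2 hFt32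
  -- (5) the floor and the bump: `q · √F · e < a · D`
  have hB : q * (Real.sqrt F * e) < a * D :=
    calc q * (Real.sqrt F * e) ≤ q * s := mul_le_mul_of_nonneg_left hfloor hq.le
      _ < a * D := hb
  -- (6) `√F = √F_t · √D`; combine and cancel `√F_t · √D`
  have hsqF : Real.sqrt F = Real.sqrt Ft * Real.sqrt D := by rw [hFD, Real.sqrt_mul hFt.le]
  have hDD : Real.sqrt D * Real.sqrt D = D := Real.mul_self_sqrt hD.le
  have hC : q * (e * e1 * e) * (Real.sqrt Ft * Real.sqrt D) <
      Real.sqrt D * (Real.sqrt Ft * Real.sqrt D) := by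
    calc q * (e * e1 * e) * (Real.sqrt Ft * Real.sqrt D)
        = q * (Real.sqrt F * e) * (e1 * e) := by rw [hsqF]; ring
      _ < a * D * (e1 * e) := mul_lt_mul_of_pos_right hB (mul_pos he1 he)
      _ = a * (e1 * e) * D := by ring
      _ ≤ Real.sqrt Ft * D := mul_le_mul_of_nonneg_right hA hD.le
      _ = Real.sqrt D * (Real.sqrt Ft * Real.sqrt D) := by
          linear_combination (-Real.sqrt Ft) * hDD
  have hpos : 0 < Real.sqrt Ft * Real.sqrt D :=
    mul_pos (Real.sqrt_pos.mpr hFt) (Real.sqrt_pos.mpr hD)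
  have hC' : q * (e * e1 * e) < Real.sqrt D := lt_of_mul_lt_mul_right hC hpos.le
  -- (7)-(8) logarithms: `(1/2+ε)t·log n - 2c√n + c + 1 < (t/2)·log n`
  have hqE : 0 < q * (e * e1 * e) := mul_pos hq (mul_pos (mul_pos he he1) he)
  have hlog := Real.log_lt_log hqE hC'
  have hlhs : Real.log (q * (e * e1 * e)) =
      (1 / 2 + ε) * (t : ℝ) * Real.log n + (-(c * Real.sqrt (n : ℝ)) + (c + 1) +
        -(c * Real.sqrt (n : ℝ))) := by
    rw [Real.log_mul hq.ne' (mul_pos (mul_pos he he1) he).ne',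
      Real.log_mul (mul_pos he he1).ne' he.ne', Real.log_mul he.ne' he1.ne', hq_def,
      Real.log_rpow hnpos, he_def, he1_def, Real.log_exp, Real.log_exp]
  have hrhs : Real.log (Real.sqrt D) ≤ (t : ℝ) * Real.log n / 2 := by
    rw [Real.log_sqrt hD.le]
    have : Real.log D ≤ Real.log ((n : ℝ) ^ t) := Real.log_le_log hD hDle
    rw [Real.log_pow] at this
    linarith
  rw [hlhs] at hlog
  have key : (1 / 2 + ε) * (t : ℝ) * Real.log n + (-(c * Real.sqrt (n : ℝ)) + (c + 1) +
      -(c * Real.sqrt (n : ℝ))) < (t : ℝ) * Real.log n / 2 := lt_of_lt_of_le hlog hrhs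
  linarith only [key, hlevel]

end Summit.MatrixMultiplication.MatrixMultiplication.Theorems.JuntaBranch
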